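/-
Copyright (c) 2026 the pub-hodgecm-mathlib formalisation cell (harness21).  R90-TF SLAB, section S10 (Rogawski 1990, §13.6–13.8 read at `v`),
prover R90-C138-p07 (g0) — card W1-H4′ (b) (DEAL #4 (g2) (5), RULING J-F-2′ 2026-09-04); h413 = `stmt-HodgeConjecture-24833`, route `HCCMUnconditional`.
-/
import Summits.HodgeConjecture.HodgeConjecture.Theorems.R90S10GermPinsOfRecordDefs   -- ★ W1-H4′ (a): `heckeBoundOfRecord`, `heckeStarOfRecord`, `bdRec`, `σRec` + specs
import Summits.HodgeConjecture.HodgeConjecture.Theorems.R90S10GermOfDiscreteClass    -- ★ p862155: `germOfDiscreteClass` (+ ★ `clFinChoice`, `trivialClass`, `evpAtIntegralLevel`)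
import HarnessLib

/-!
# R90-TF ∕ S10 — W1-H4′ (b): EVERY GERM OF A DISCRETE CLASS LIES IN `GermSub S bd σ` AT THE PINS OF RECORD (F's `hRepGerm`, ALL `c`)
# (`Theorems/R90S10GermOfRecordMem.lean`; ns `Summit.HodgeConjecture.HodgeConjecture.R90.S10`; theorems only)

Print: [Rogawski1990] §13.6 p. 209 «`t_v` is the homomorphism by which `𝓗_v` acts on the `K_v`-fixed vector in `π_v`»; §10.3 p. 159 «the `z_j` are contained in
a compact subset» (e.v.p.'s of UNITARY representations are bounded); §13.7 p. 213.  [DeitmarEchterhoff2014] Prop. 6.2.1 «`π(f)^* = π(f^*)`, `‖π(f)‖ ≤ ‖f‖₁`».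

## WHAT THIS FILE PROVES (sorry-free; LAW L9: ★ `Theorems` ∕ ★ `Literature` imports only)
* §1 (generic Hecke pair `(G, K)`): for a `K`-SPHERICAL UNITARIZABLE representation `ρ` (★ `Representation.IsSpherical`, ★ `Representation.IsUnitarizable`)
  and `x ∈ ℋ(G, K)`: **`‖χ_ρ(op x)‖ ≤ heckeBoundOfRecord K x`** and **`χ_ρ(op (heckeStarOfRecord K x)) = conj (χ_ρ(op x))`** for the spherical functional
  `χ_ρ` (★ `sphericalFunctional`) — on the spherical LINE `V^K = ℂe`, `x·e = χ_ρ(x) e` (★ `fixedPointsAlgHom_apply_eq_smul`), so the ★ bound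
  `re B(x·e, x·e) ≤ bd(x)² re B(e,e)` reads `‖χ_ρ(x)‖² ≤ bd(x)²` and the ★ adjoint law `B(x·e, e) = B(e, σ(x)·e)` reads `conj χ_ρ(x) = χ_ρ(σ x)` (`B` conjugate-linear
  in its first slot, `re B(e,e) > 0`); then the CLASS versions (★ `classSphericalFunctional`, ★ `IrrClass.IsSpherical`, ★ `IrrClass.IsUnitarizable`) by ★ `IrrClass.ind`.
* §2 (CM, any `H ∈ M₃(L)`, any automorphic `μ`, any `S`): **`germOfDiscreteClass_mem_germSub`** — for EVERY discrete class `c` of `U(H)`: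
  `(∀ i x, ‖germOfDiscreteClass S c i x‖ ≤ bdRec L H S i x) ∧ ∀ i x, germOfDiscreteClass S c i (σRec L H S i x) = conj (germOfDiscreteClass S c i x)` —
  FILE F's obligation `hRepGerm` (`Cruxes/H413/Lines/R90_S10_TwistedDatumF.lean` :182–:183) AT THE PINS OF RECORD `bd := bdRec L (splitForm L 3) S`,
  `σ := σRec L (splitForm L 3) S`, token for token, for ALL `c` (not only the class of record): BOTH branches of ★ `germOfDiscreteClass` are e.v.p.'s
  (★ `evpAtIntegralLevel`) of UNITARIZABLE SPHERICAL classes — the chosen local classes ★ `clFinChoice c.out v` (★ `clFinChoice_isUnitarizable`, UNCONDITIONAL: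
  local constituents of a discrete automorphic representation are unitarizable) resp. the trivial class (★ `trivialClass_isUnitarizable`, ★ `trivialClass_isSpherical`).
CONSEQUENCES (by name, no byte change anywhere): J-F-2's `𝔗.hRepGerm := germOfDiscreteClass_mem_germSub S`; S5-D `Hrec`'s `(∀ i, σ i 1 = 1)` := ★ `σRec_one`; PAYER-TABLE-D2
row D5 (`t₀ ∈ GermSub`) := this theorem at the class of record.
HONEST LABEL: ★-level algebra over ★ (U2) `HeckeOperatorUnitaryAdjoint`; pays no socket until an edition∕`Hrec` names it; HC_CM is proved only modulo the 7 printed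
citations (2 remaining named inputs: hLiu418 = `stmt-HodgeConjecture-24832`, h413 = `stmt-HodgeConjecture-24833`) until rung 0 closes; REL ≠ ★ ≠ BUILT.
-/

set_option autoImplicit false
set_option linter.dupNamespace false

noncomputable section

open MeasureTheory NumberField IsDedekindDomain
open Literature.NumberTheory.Automorphic Literature.NumberTheory.Automorphic.UnitaryGroup
open Literature.NumberTheory.Rogawski1990
open Summit.HodgeConjecture.HodgeConjecture.Cruxes.H413.K2E1EigenvaluePackageOfSpherical
open Summit.HodgeConjecture.HodgeConjecture.Cruxes.H413.K2E1EvpOfAutomorphicClass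
open Summit.HodgeConjecture.HodgeConjecture.Cruxes.H413.K2E1SpectralTermsDiscreteHalf (DiscreteClass)
open Summit.HodgeConjecture.HodgeConjecture.Cruxes.H413.F0P3ClassTokenChoice

namespace Summit.HodgeConjecture.HodgeConjecture.R90.S10

universe u

/-! ## §1 Generic Hecke pair: the spherical functional of a unitarizable spherical representation is `bd`-bounded and `σ`-star-fixed -/

section Generic

variable {G : Type u} [Group G] (K : Subgroup G) [IsHeckeTriple (⊤ : Submonoid G) K K]

omit [IsHeckeTriple (⊤ : Submonoid G) K K] in
/-- A `K`-spherical representation has a NON-ZERO `K`-fixed vector (`dim V^K = 1`). [cite: CartierCorvallis1979, §IV.1 Cor. 4.1] -/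
theorem exists_ne_zero_fixedPoints_of_isSpherical {V : Type} [AddCommGroup V] [Module ℂ V] (ρ : Representation ℂ G V) (h1 : ρ.IsSpherical K) :
    ∃ e : ρ.fixedPoints K, e ≠ 0 := by
  haveI : Module.Finite ℂ (ρ.fixedPoints K) := Module.finite_of_finrank_eq_succ h1
  have hpos : 0 < Module.finrank ℂ (ρ.fixedPoints K) := by
    rw [Representation.isSpherical_iff] at h1
    rw [h1]
    exact one_pos
  exact Module.finrank_pos_iff_exists_ne_zero.1 hpos

/-- **`‖χ_ρ(op x)‖ ≤ bd(x)`** for a `K`-spherical UNITARIZABLE `ρ` («`‖π(f)‖ ≤ ‖f‖₁`» read on the spherical line: `x·e = χ_ρ(x) e`, so the ★ bound of record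
`re B(x·e, x·e) ≤ bd(x)² · re B(e, e)` is `‖χ_ρ(x)‖² · re B(e,e) ≤ bd(x)² · re B(e,e)` with `re B(e,e) > 0`). [cite: DeitmarEchterhoff2014, Prop. 6.2.1]
[cite: Rogawski1990, §10.3 p. 159] -/
theorem norm_sphericalFunctional_le_heckeBoundOfRecord {V : Type} [AddCommGroup V] [Module ℂ V] (ρ : Representation ℂ G V)
    (h1 : ρ.IsSpherical K) (hU : ρ.IsUnitarizable) (x : heckeAlgebra ℂ G K) :
    ‖sphericalFunctional K ρ (MulOpposite.op x)‖ ≤ heckeBoundOfRecord K x := by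
  obtain ⟨B, hBs, hpos, hB⟩ := hU
  obtain ⟨e, he⟩ := exists_ne_zero_fixedPoints_of_isSpherical K ρ h1
  have he' : (e : V) ≠ 0 := fun h => he (Subtype.ext h)
  have hact : (heckeAlgebra.fixedPointsAlgHom K ρ (MulOpposite.op x) e : V) = sphericalFunctional K ρ (MulOpposite.op x) • (e : V) := by
    rw [fixedPointsAlgHom_apply_eq_smul K ρ h1, Submodule.coe_smul]
  have hspec := heckeBoundOfRecord_spec K x ρ B hBs hpos hB e
  have hsm : ∀ (c : ℂ) (u : V), (B (c • u) (c • u)).re = ‖c‖ ^ 2 * (B u u).re := fun c u => by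
    rw [LinearMap.map_smulₛₗ₂, map_smul, smul_eq_mul, smul_eq_mul, ← mul_assoc, starRingEnd_apply, Complex.star_def,
      Complex.conj_mul', ← Complex.ofReal_pow, Complex.re_ofReal_mul]
  rw [hact, hsm] at hspec
  have hsq : ‖sphericalFunctional K ρ (MulOpposite.op x)‖ ^ 2 ≤ heckeBoundOfRecord K x ^ 2 :=
    le_of_mul_le_mul_right hspec (hpos _ he')
  exact (pow_le_pow_iff_left₀ (norm_nonneg _) (heckeBoundOfRecord_nonneg K x) two_ne_zero).1 hsq

/-- **`χ_ρ(op (σ x)) = conj (χ_ρ(op x))`** for a `K`-spherical UNITARIZABLE `ρ` («`π(f)^* = π(f^*)`» read on the spherical line: the ★ adjoint law of record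
`B(x·e, e) = B(e, σ(x)·e)` is `conj χ_ρ(x) · B(e,e) = χ_ρ(σ x) · B(e,e)` with `B(e,e) ≠ 0`). [cite: DeitmarEchterhoff2014, Prop. 6.2.1] [cite: Rogawski1990, §13.7 p. 213] -/
theorem sphericalFunctional_heckeStarOfRecord {V : Type} [AddCommGroup V] [Module ℂ V] (ρ : Representation ℂ G V)
    (h1 : ρ.IsSpherical K) (hU : ρ.IsUnitarizable) (x : heckeAlgebra ℂ G K) :
    sphericalFunctional K ρ (MulOpposite.op (heckeStarOfRecord K x)) = (starRingEnd ℂ) (sphericalFunctional K ρ (MulOpposite.op x)) := by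
  obtain ⟨B, -, hpos, hB⟩ := hU
  obtain ⟨e, he⟩ := exists_ne_zero_fixedPoints_of_isSpherical K ρ h1
  have he' : (e : V) ≠ 0 := fun h => he (Subtype.ext h)
  have hne : B (e : V) e ≠ 0 := fun h0 => by
    have h := hpos _ he'
    rw [h0, Complex.zero_re] at h
    exact lt_irrefl _ h
  have hact : (heckeAlgebra.fixedPointsAlgHom K ρ (MulOpposite.op x) e : V) = sphericalFunctional K ρ (MulOpposite.op x) • (e : V) := by
    rw [fixedPointsAlgHom_apply_eq_smul K ρ h1, Submodule.coe_smul]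
  have hact' : (heckeAlgebra.fixedPointsAlgHom K ρ (MulOpposite.op (heckeStarOfRecord K x)) e : V) =
      sphericalFunctional K ρ (MulOpposite.op (heckeStarOfRecord K x)) • (e : V) := by
    rw [fixedPointsAlgHom_apply_eq_smul K ρ h1, Submodule.coe_smul]
  have hspec := heckeStarOfRecord_spec K x ρ B hB e e
  rw [hact, hact', LinearMap.map_smulₛₗ₂, map_smul, smul_eq_mul, smul_eq_mul] at hspec
  exact (mul_right_cancel₀ hne hspec).symm

variable [TopologicalSpace G]

/-- **CLASS form of the bound**: `‖χ_c(op x)‖ ≤ bd(x)` for a `K`-spherical unitarizable class `c ∈ Irr(G)` (★ `classSphericalFunctional`).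
[cite: DeitmarEchterhoff2014, Prop. 6.2.1] [cite: Rogawski1990, §10.3 p. 159] -/
theorem norm_classSphericalFunctional_le_heckeBoundOfRecord (c : IrrClass G) (h : c.IsSpherical K) (hU : c.IsUnitarizable) (x : heckeAlgebra ℂ G K) :
    ‖classSphericalFunctional K c (MulOpposite.op x)‖ ≤ heckeBoundOfRecord K x := by
  induction c using IrrClass.ind with
  | h r => exact norm_sphericalFunctional_le_heckeBoundOfRecord K r.ρ ((IrrClass.isSpherical_mk r K).1 h) ((IrrClass.isUnitarizable_mk r).1 hU) x

/-- **CLASS form of the star law**: `χ_c(op (σ x)) = conj (χ_c(op x))` for a `K`-spherical unitarizable class `c ∈ Irr(G)`.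
[cite: DeitmarEchterhoff2014, Prop. 6.2.1] [cite: Rogawski1990, §13.7 p. 213] -/
theorem classSphericalFunctional_heckeStarOfRecord (c : IrrClass G) (h : c.IsSpherical K) (hU : c.IsUnitarizable) (x : heckeAlgebra ℂ G K) :
    classSphericalFunctional K c (MulOpposite.op (heckeStarOfRecord K x)) = (starRingEnd ℂ) (classSphericalFunctional K c (MulOpposite.op x)) := by
  induction c using IrrClass.ind with
  | h r => exact sphericalFunctional_heckeStarOfRecord K r.ρ ((IrrClass.isSpherical_mk r K).1 h) ((IrrClass.isUnitarizable_mk r).1 hU) x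

end Generic

/-! ## §2 CM: every germ of a discrete class of `U(H)` lies in `GermSub S (bdRec …) (σRec …)` -/

section CM

variable {L : Type} [Field L] [NumberField L] [IsCMField L] {H : Matrix (Fin 3) (Fin 3) L}
variable {μ : Measure (adelicGroupData (↥(maximalRealSubfield L)) L (IsCMField.complexConj L) 3 H).automorphicQuotient}
  [(adelicGroupData (↥(maximalRealSubfield L)) L (IsCMField.complexConj L) 3 H).IsAutomorphicMeasure μ]

/-- The e.v.p. at the integral levels of a family that is spherical AND UNITARIZABLE off `S` is `bdRec`-bounded and `σRec`-star-fixed (both pins of record read on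
★ `evpAtIntegralLevel … i x = χ_{π_i}(op x)`). [cite: Rogawski1990, §13.6 p. 209; §10.3 p. 159] -/
theorem evpAtIntegralLevel_mem_germSub (S : Set (HeightOneSpectrum (𝓞 ↥(maximalRealSubfield L))))
    (π : ∀ v : HeightOneSpectrum (𝓞 ↥(maximalRealSubfield L)), IrrClass ((cmDatum L 3 H).Local v))
    (hπ : ∀ v, v ∉ S → (π v).IsSpherical (cmLocalIntegralLevel L 3 H v)) (hU : ∀ v, v ∉ S → (π v).IsUnitarizable) :
    (∀ (i : {i : HeightOneSpectrum (𝓞 ↥(maximalRealSubfield L)) // i ∉ S})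
        (x : heckeAlgebra ℂ ((cmDatum L 3 H).Local i.1) (cmLocalIntegralLevel L 3 H i.1)),
        ‖evpAtIntegralLevel L 3 H π S hπ i x‖ ≤ bdRec L H S i x) ∧
      ∀ (i : {i : HeightOneSpectrum (𝓞 ↥(maximalRealSubfield L)) // i ∉ S})
        (x : heckeAlgebra ℂ ((cmDatum L 3 H).Local i.1) (cmLocalIntegralLevel L 3 H i.1)),
        evpAtIntegralLevel L 3 H π S hπ i (σRec L H S i x) = (starRingEnd ℂ) (evpAtIntegralLevel L 3 H π S hπ i x) := by
  refine ⟨fun i x => ?_, fun i x => ?_⟩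
  · haveI := isHeckeTriple_cmLocalIntegralLevel L H i.1
    exact norm_classSphericalFunctional_le_heckeBoundOfRecord (cmLocalIntegralLevel L 3 H i.1) (π i.1) (hπ i.1 i.2) (hU i.1 i.2) x
  · haveI := isHeckeTriple_cmLocalIntegralLevel L H i.1
    exact classSphericalFunctional_heckeStarOfRecord (cmLocalIntegralLevel L 3 H i.1) (π i.1) (hπ i.1 i.2) (hU i.1 i.2) x

/-- **W1-H4′ — EVERY GERM OF A DISCRETE CLASS LIES IN `GermSub S bd σ` AT THE PINS OF RECORD** (FILE F's `hRepGerm` body, token for token, for ALL `c`):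
for every discrete class `c` of `U(H)`, its e.v.p. `t(c)` off `S` (★ `germOfDiscreteClass S c`) satisfies `‖t(c)_i(x)‖ ≤ bdRec i x` and
`t(c)_i(σRec i x) = conj (t(c)_i(x))` for all `i ∉ S`, `x ∈ 𝓗_i` — the germ of a discrete class is BOUNDED and STAR-FIXED because its local classes are UNITARIZABLE
(★ `clFinChoice_isUnitarizable`; trivial branch ★ `trivialClass_isUnitarizable`) [«the `z_j` are contained in a compact subset», §10.3 p. 159; `t_v(f^*) = conj t_v(f)`].
[cite: Rogawski1990, §13.6 p. 209; §10.3 p. 159; §13.7 p. 213] [cite: DeitmarEchterhoff2014, Prop. 6.2.1] -/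
theorem germOfDiscreteClass_mem_germSub (S : Set (HeightOneSpectrum (𝓞 ↥(maximalRealSubfield L))))
    (c : DiscreteClass (adelicGroupData (↥(maximalRealSubfield L)) L (IsCMField.complexConj L) 3 H) μ) :
    (∀ (i : {i : HeightOneSpectrum (𝓞 ↥(maximalRealSubfield L)) // i ∉ S})
        (x : heckeAlgebra ℂ ((cmDatum L 3 H).Local i.1) (cmLocalIntegralLevel L 3 H i.1)),
        ‖germOfDiscreteClass S c i x‖ ≤ bdRec L H S i x) ∧
      ∀ (i : {i : HeightOneSpectrum (𝓞 ↥(maximalRealSubfield L)) // i ∉ S})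
        (x : heckeAlgebra ℂ ((cmDatum L 3 H).Local i.1) (cmLocalIntegralLevel L 3 H i.1)),
        germOfDiscreteClass S c i (σRec L H S i x) = (starRingEnd ℂ) (germOfDiscreteClass S c i x) := by
  by_cases h : ∀ v, v ∉ S → (clFinChoice c.out v).IsSpherical (cmLocalIntegralLevel L 3 H v)
  · rw [germOfDiscreteClass_of_isSpherical S c h]
    exact evpAtIntegralLevel_mem_germSub S (fun v => clFinChoice c.out v) h (fun v _ => clFinChoice_isUnitarizable c.out v)
  · rw [germOfDiscreteClass, dif_neg h]
    exact evpAtIntegralLevel_mem_germSub S (fun v => trivialClass v) (fun v _ => trivialClass_isSpherical v _)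
      (fun v _ => trivialClass_isUnitarizable v)

end CM

end Summit.HodgeConjecture.HodgeConjecture.R90.S10

end
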